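import Summits.QuantumFields.YangMills.Theorems.BalabanUVNodesN18TowerKeyedFaces
import Literature.MathematicalPhysics.QuantumFieldTheory.Balaban1983to89.Node00.RateRecord11

/-!
# BalabanUVNodes ∕ node N18 = NE5 — `N18At` AT THE LEVEL BUNDLES OF THE RATE-RECORD HOME (layer A `Node00/RateRecord11`, p455395): the bundle of
# record `⟨u.levelCarriers k, Window γ, γ, u.κ, u.EA k, u.EB k, u.θ₅, u.C₅, u.moduli, u.C₉, u.ω, u.cr, u.ρ⟩` of ONE construction's U3 objects
# `u : Node00.U3Objects₁₁` at run length `k`, READ (`Iff.rfl`) and INHABITED BY NAME in both readings of record — the FIXED-CARRIER reading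
# `U3Objects₁₁.ofFixed` (W1's ∕ the H-layer END's shape) and the TOWER reading `U3Tower₁₁.objects` (comap + window agreement)

Cell `pub-ymgap`, HUMAN RULING D-0062 (Track A), R134 seat `pub-ymgap-dag-n18-d` (strategy s2: by-name knit at the ₁₁ record), generation 0, module 4.  THEOREMS ONLY
(0 `def`); imports this seat's module 3 (p454447: `n18At_congr`, `n18At_comap_congr`; through it module 1 p451455: `n18At_of_envelopeOnRecord`, `n18At_comap`,
and `N18AtByName.n18At_mono`) and NODE 00's rate-record home LAYER A (`Node00/RateRecord11.lean` p455395, seat node00-def-RR-1: `U3Letters₁₁`, `U3Objects₁₁` with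
`levelCarriers ∕ EA ∕ EB` per run length, `U3Tower₁₁.objects`, `U3Objects₁₁.ofFixed`, `prependCoupling`); modifies nothing; `--supports stmt-QuantumFields-19676` (K3).

THE HOME's N18 SLOT (node00-def-RR-1 INTENT-1 ∕ FILED, pub-ymgap INBOX 2026-08-26T14:54Z ∕ 15:57Z; layer B = seat n22-e): the U3 bundle of a record keyed by
`(θ, w)` at run length `k` is `u3OfRecord₁₁ w.γ u k := ⟨u.levelCarriers k, Window w.γ, w.γ, u.κ, u.EA k, u.EB k, u.θ₅, u.C₅, u.moduli, u.C₉, u.ω, u.cr, u.ρ⟩` with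
`u := (𝔯 F θ g₀ os).u3 : U3Objects₁₁`, and `S_N18 (RRec₁₁ 𝔯 𝔱)` unfolds (one `rintro ⟨θ, w, k, hkey, rfl⟩`) to `N18At` of that literal at every key and level.
THIS FILE states N18 at exactly that literal (so layer B's one-application is `exact` ∕ `Iff.rfl` whatever spelling it gives the def):
* §1 `n18At_level_iff` — the READING (`Iff.rfl`): `N18At ⟨u.levelCarriers k, Window γ, γ, u.κ, u.EA k, u.EB k, u.θ₅, u.C₅, …⟩ ↔ ∀ b ∈ ]0, γ],
  NE5 (u.EA k) (u.EB k b) (Window γ) u.κ u.θ₅ u.C₅` on `u.levelCarriers k`.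
* §2 FIXED-CARRIER READING (`u := U3Objects₁₁.ofFixed C EA EB ℓ` — ONE pair-carrier structure read at every run length; W1's `histCarriers ∕ functional` and the
  H-layer END's `TwoRuns.carriers` are of this shape): `n18At_level_ofFixed_iff` (the level-`k` bundle's N18 IS `N18At ⟨C, Window γ, γ, ℓ.κ, EA, EB, ℓ.θ₅, ℓ.C₅, …⟩`,
  every `k`, `Iff.rfl`); `n18At_level_ofFixed_of_mono` (from `N18At` at `C` on any window `⊇ Window γ`, radius `≥ γ`, decay `≥ ℓ.κ`, rate `θ ≤ ℓ.θ₅`, constant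
  `C₅ ≤ ℓ.C₅` — the record's letters need only DOMINATE an END's; `N18AtByName.n18At_mono`); `n18At_level_ofFixed_of_envelopeOnRecord` (∘ module 1: the H-layer END
  on a two-run datum `Rr` gives N18 at EVERY level of `ofFixed Rr.carriers EA EB ℓ` once `ℓ.θ₅, ℓ.C₅` dominate the END's `θ′, C₅(C₃ε₁)` and `ℓ.κ ≤ κ`).
* §3 TOWER READING (`u := t.objects ℓ`, `t : U3Tower₁₁` — ONE physical domain type, level `k` = scale `k − r X`, ONE background type, transports `t.tr k`, level
  functionals `t.E k`, run B through `prependCoupling`): `n18At_level_tower_of_comap_agree` (∘ module 3: from ANY bundle `v` with `N18At v`, maps `t.Dom → v.C.Dom`,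
  `t.B → v.C.BgA ∕ v.C.BgB` with the three compatibilities AT LEVEL `k`, agreement on `Window γ` of `t.E k` (at transported backgrounds) and
  `t.E (k+1) ∘ prependCoupling b` with `v`'s functionals through the maps, and letter domination).
So for either constructor of record N18 at the home is ONE application of a theorem of this file; what remains is CONTENT: an END bundle for Bałaban's objects
(module 1 ∕ 2: the H-layer datum ∕ term data + leaves; or n18-a's primitive-rate END) and, in the tower reading, the level maps + agreement.
HONEST FRAMING.  Kernel bookkeeping (`Iff.rfl`, `n18At_mono`, `n18At_comap_congr`); 0 sorry; restates nothing; layer B (`RRec₁₁`, `u3OfRecord₁₁`) is NOT in the tree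
at filing and is not typed here (seat n22-e); the residual assignment `𝔯` is a PARAMETER of the home — N18 over a junk `𝔯` is refutable (`YMDAG.N18.not_s_N18_of_admits`),
over W1's objects it is NE5's content; NE5 NOT IN PRINT ([Balaban1987RG1] Thm 1 p. 259) ∕ NOT proved; N18 NOT discharged (typed 28∕28 · discharged 5∕28 unmoved).
One finite four-torus at fixed ε; NOT infinite volume, NOT OS on ℝ⁴, NOT a mass gap, NOT Clay.
-/

noncomputable section

namespace YMDAG.N18.HLayer

open Literature.MathematicalPhysics.QuantumFieldTheory.Balaban1983to89
open Literature.MathematicalPhysics.QuantumFieldTheory.Balaban1983to89.T4Continuum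
open Literature.MathematicalPhysics.QuantumFieldTheory.Balaban1983to89.T4OutputRate (Carriers Functional NE5 Window)
open Literature.MathematicalPhysics.QuantumFieldTheory.Balaban1983to89.T4InputCauchyRateData (StepModel)
open Literature.MathematicalPhysics.QuantumFieldTheory.Balaban1983to89.B13Resummation (locE)
open Literature.MathematicalPhysics.QuantumFieldTheory.Balaban1983to89.TreeLengthTorus (TDom tsys torusTreeLen)
open Literature.MathematicalPhysics.QuantumFieldTheory.Balaban1983to89.TreeLengthTorusGeometry (TTouch)
open Literature.MathematicalPhysics.QuantumFieldTheory.Balaban1983to89.B12TreeDecay (K₀)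
open Literature.MathematicalPhysics.QuantumFieldTheory.Balaban1983to89.Node00 (U3Letters₁₁ U3Objects₁₁ U3Tower₁₁ prependCoupling)
open Summit.QuantumFields.BalabanUV.T4Continuum.B13Carriers (TwoRuns)
open Summit.QuantumFields.BalabanUV.T4Continuum.Spine.NE5
open Summit.QuantumFields.YangMills.BalabanUVNodes.N18AtByName (n18At_mono)
open YMDAG.UVSplit

/-! ## §1 The reading of N18 at a level bundle of the home -/

/-- **WHAT N18 SAYS AT THE HOME's LEVEL-`k` BUNDLE** (`Iff.rfl`): for the U3 objects `u` of one construction, window radius `γ` and run length `k`, `N18At` at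
`⟨u.levelCarriers k, Window γ, γ, u.κ, u.EA k, u.EB k, u.θ₅, u.C₅, u.moduli, u.C₉, u.ω, u.cr, u.ρ⟩` IS: for every member `b ∈ ]0, γ]` of run B's first-coupling
family, the two-run η-rate `NE5 (u.EA k) (u.EB k b) (Window γ) u.κ u.θ₅ u.C₅` on the level-`k` pair carriers. [cite: Balaban1987RG1, Thm 1 p.259 and (1.18) p.263] -/
theorem n18At_level_iff (u : U3Objects₁₁) (γ : ℝ) (k : ℕ) :
    N18At ⟨u.levelCarriers k, Window γ, γ, u.κ, u.EA k, u.EB k, u.θ₅, u.C₅, u.moduli, u.C₉, u.ω, u.cr, u.ρ⟩ ↔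
      ∀ b : ℝ, 0 < b → b ≤ γ → NE5 (u.EA k) (u.EB k b) (Window γ) u.κ u.θ₅ u.C₅ :=
  Iff.rfl

/-! ## §2 The fixed-carrier reading `U3Objects₁₁.ofFixed` -/

section Fixed

variable (C : Carriers) (EA : Functional C C.BgA) (EB : ℝ → Functional C C.BgB) (ℓ : U3Letters₁₁) (γ : ℝ) (k : ℕ)

/-- **FIXED CARRIERS: THE LEVEL-`k` BUNDLE's N18 IS `N18At` AT THE FIXED BUNDLE, EVERY `k`** (`Iff.rfl`): for `u := U3Objects₁₁.ofFixed C EA EB ℓ` (one pair-carrier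
structure `C` with run A's functional `EA` and run B's family `EB` read at every run length, letter block `ℓ`) the home's level-`k` bundle is literally
`⟨C, Window γ, γ, ℓ.κ, EA, EB, ℓ.θ₅, ℓ.C₅, ℓ.moduli, ℓ.C₉, ℓ.ω, ℓ.cr, ℓ.ρ⟩`. [cite: Balaban1989LargeFieldII, (2.13)–(2.14) p.359; Balaban1987RG1, Thm 1 p.259] -/
theorem n18At_level_ofFixed_iff :
    N18At ⟨(U3Objects₁₁.ofFixed C EA EB ℓ).levelCarriers k, Window γ, γ, (U3Objects₁₁.ofFixed C EA EB ℓ).κ,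
        (U3Objects₁₁.ofFixed C EA EB ℓ).EA k, (U3Objects₁₁.ofFixed C EA EB ℓ).EB k, (U3Objects₁₁.ofFixed C EA EB ℓ).θ₅,
        (U3Objects₁₁.ofFixed C EA EB ℓ).C₅, (U3Objects₁₁.ofFixed C EA EB ℓ).moduli, (U3Objects₁₁.ofFixed C EA EB ℓ).C₉,
        (U3Objects₁₁.ofFixed C EA EB ℓ).ω, (U3Objects₁₁.ofFixed C EA EB ℓ).cr, (U3Objects₁₁.ofFixed C EA EB ℓ).ρ⟩ ↔
      N18At ⟨C, Window γ, γ, ℓ.κ, EA, EB, ℓ.θ₅, ℓ.C₅, ℓ.moduli, ℓ.C₉, ℓ.ω, ℓ.cr, ℓ.ρ⟩ :=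
  Iff.rfl

variable {C EA EB γ}

/-- **FIXED CARRIERS: THE RECORD's LETTERS NEED ONLY DOMINATE AN END's** [bookkeeping]: `N18At` at `C` on any window `W ⊇ Window γ` with radius `γ′ ≥ γ`, decay
`κ′ ≥ ℓ.κ`, rate `0 ≤ θ ≤ ℓ.θ₅` and constant `0 ≤ C₅ ≤ ℓ.C₅` (any NE9 ∕ read-out letters) gives N18 at EVERY level of `U3Objects₁₁.ofFixed C EA EB ℓ`
(`N18AtByName.n18At_mono`). [cite: Balaban1987RG1, Thm 1 p.259] -/
theorem n18At_level_ofFixed_of_mono {W : Set (ℕ → ℝ)} {γ' κ' θ C₅ : ℝ} {Λ : ℕ → ℕ → ℝ} {C₉ ωm cr ρ : ℝ}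
    (h : N18At ⟨C, W, γ', κ', EA, EB, θ, C₅, Λ, C₉, ωm, cr, ρ⟩) (hW : Window γ ⊆ W) (hγ : γ ≤ γ') (hκ : ℓ.κ ≤ κ') (hθ : 0 ≤ θ)
    (hθ' : θ ≤ ℓ.θ₅) (hC₅ : 0 ≤ C₅) (hC : C₅ ≤ ℓ.C₅) :
    N18At ⟨(U3Objects₁₁.ofFixed C EA EB ℓ).levelCarriers k, Window γ, γ, (U3Objects₁₁.ofFixed C EA EB ℓ).κ,
        (U3Objects₁₁.ofFixed C EA EB ℓ).EA k, (U3Objects₁₁.ofFixed C EA EB ℓ).EB k, (U3Objects₁₁.ofFixed C EA EB ℓ).θ₅,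
        (U3Objects₁₁.ofFixed C EA EB ℓ).C₅, (U3Objects₁₁.ofFixed C EA EB ℓ).moduli, (U3Objects₁₁.ofFixed C EA EB ℓ).C₉,
        (U3Objects₁₁.ofFixed C EA EB ℓ).ω, (U3Objects₁₁.ofFixed C EA EB ℓ).cr, (U3Objects₁₁.ofFixed C EA EB ℓ).ρ⟩ :=
  (n18At_level_ofFixed_iff C EA EB ℓ γ k).2 (n18At_mono h hW hγ hκ hθ hθ' hC₅ hC)

end Fixed

section FixedEnvelope

variable {G : Type} [GaugeGroup G] (Rr : TwoRuns G)
variable {Op Hist : Type*} [NormedAddCommGroup Op] [NormedSpace ℂ Op] [NormedAddCommGroup Hist] [NormedSpace ℂ Hist]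
variable [∀ j, DecidableEq (TDom 4 (Rr.cubesPerDir j))] [∀ j, DecidableRel (TTouch (d := 4) (N := Rr.cubesPerDir j))]

/-- **THE H-LAYER END AT EVERY LEVEL OF THE FIXED-CARRIER HOME ON THE CARRIERS OF RECORD** [bookkeeping] — module 1's `n18At_of_envelopeOnRecord` ∘
`n18At_level_ofFixed_of_mono`: for a two-run datum `Rr`, per-member step models and activities carrying (2.13), THE NODE-A MAJORANT AS HYPOTHESIS and the leaves
(module 1's binder list verbatim, on a window `W ⊇ Window γ` with radius `γ′ ≥ γ`), and a letter block `ℓ` of record with `ℓ.κ ≤ κ`, `θ′ ≤ ℓ.θ₅`,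
`C₅(C₃ε₁) ≤ ℓ.C₅`: N18 holds at EVERY level `k` of `U3Objects₁₁.ofFixed Rr.carriers EA EB ℓ` — the home's fixed-carrier bundle for the H-layer functionals.
[cite: Balaban1988RG2Cluster, Lemma 3 (2.38) p.20 and (2.13) p.14; Balaban1987RG1, Thm 1 p.259] -/
theorem n18At_level_ofFixed_of_envelopeOnRecord (M : ℝ → StepModel Rr.carriers Op Hist)
    {act : ℝ → (j : ℕ) → Op × Hist → TDom 4 (Rr.cubesPerDir j) → ℂ} {W : Set (ℕ → ℝ)} {γ γ' C3 ε₁ Rd κ : ℝ}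
    {EA : Functional Rr.carriers Rr.carriers.BgA} {EB : ℝ → Functional Rr.carriers Rr.carriers.BgB}
    {EA₀ E₀ E₁ δ δ' θ θ' cH ω ρ₀ B : ℝ} {k₀ : ℕ}
    (hrep : ∀ b : ℝ, 0 < b → b ≤ γ' → ∀ (X : Rr.carriers.Dom) (z : Op × Hist),
      (M b).Out X.1 z.1 z.2 X =
        locE (TTouch (d := 4) (N := Rr.cubesPerDir X.1)) (fun Z : (tsys 4 (Rr.cubesPerDir X.1)).Dom => Z.1) (act b X.1 z) X.2.1)
    (hC3 : 0 ≤ C3) (hε₁ : 0 ≤ ε₁) (hκ : 0 ≤ κ) (hrate : κ + 2 * (64 * Real.log 162) + 2 ≤ Rd)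
    (hKP : C3 * ε₁ * Real.exp (5 * κ + 1) * K₀ 64 8 * 9 * 64 ≤ 1)
    (hH : ∀ b : ℝ, 0 < b → b ≤ γ' → ∀ j, ∀ g ∈ W, ∀ (U : Rr.carriers.BgB) (p : Op × Hist), p ∈ (M b).Base j g U →
      ∃ V : Set (Op × Hist), IsOpen V ∧ (M b).box j p ⊆ V ∧
        (∀ Z : TDom 4 (Rr.cubesPerDir j), DifferentiableOn ℂ (fun z : Op × Hist => act b j z Z) V) ∧
        (∀ z ∈ V, ∀ Z : TDom 4 (Rr.cubesPerDir j), ‖act b j z Z‖ ≤ C3 * ε₁ * Real.exp (-(Rd * torusTreeLen Z.1))))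
    (l01 : ∀ b : ℝ, 0 < b → b ≤ γ' → L01 (M b) EA W) (l02 : ∀ b : ℝ, 0 < b → b ≤ γ' → L02 (M b) (EB b) W)
    (l03 : ∀ b : ℝ, 0 < b → b ≤ γ' → L03 (M b) (EB b) W) (l05 : L05 EA W EA₀ κ)
    (l06 : ∀ b : ℝ, 0 < b → b ≤ γ' → L06 (EB b) W E₀ κ) (l07 : ∀ b : ℝ, 0 < b → b ≤ γ' → L07 (M b) W δ θ)
    (l08 : ∀ b : ℝ, 0 < b → b ≤ γ' → L08 (M b) W κ E₀ δ' θ) (l09aff : ∀ b : ℝ, 0 < b → b ≤ γ' → L09aff (M b) W)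
    (l09blind : ∀ b : ℝ, 0 < b → b ≤ γ' → L09blind (M b) W) (l09hom : ∀ b : ℝ, 0 < b → b ≤ γ' → L09hom (M b) W)
    (l09unit : ∀ b : ℝ, 0 < b → b ≤ γ' → L09unit (M b) W κ E₁ cH ω)
    (hE₁ : 0 < E₁) (hδ : 0 ≤ δ + δ') (hθ : 0 ≤ θ) (hθθ' : θ ≤ θ') (hθ'1 : θ' ≤ 1) (hcH : 0 ≤ cH) (hω : 0 < ω) (hρ₀ : ρ₀ < 1)
    (l10near : (δ + δ') * θ ^ k₀ + cH * (EA₀ + E₀) / (1 - ω) ≤ ρ₀) (hB : 0 ≤ B) (l10first : ∀ k < k₀, EA₀ + E₀ ≤ B * θ ^ k)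
    (hS : Real.exp 1 * 9 * 64 * K₀ 64 8 ^ 2 * C3 * cH * ε₁ < (θ' - ω) * (1 - ρ₀))
    (ℓ : U3Letters₁₁) (hW : Window γ ⊆ W) (hγ : γ ≤ γ') (hℓκ : ℓ.κ ≤ κ) (hℓθ : θ' ≤ ℓ.θ₅)
    (hℓC : (Real.exp 1 * 9 * 64 * K₀ 64 8 ^ 2 * (C3 * ε₁) / (1 - ρ₀) * (δ + δ') + B) * (θ' - ω) /
        (θ' - (ω + Real.exp 1 * 9 * 64 * K₀ 64 8 ^ 2 * (C3 * ε₁) / (1 - ρ₀) * cH)) ≤ ℓ.C₅)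
    (k : ℕ) :
    N18At ⟨(U3Objects₁₁.ofFixed Rr.carriers EA EB ℓ).levelCarriers k, Window γ, γ, (U3Objects₁₁.ofFixed Rr.carriers EA EB ℓ).κ,
        (U3Objects₁₁.ofFixed Rr.carriers EA EB ℓ).EA k, (U3Objects₁₁.ofFixed Rr.carriers EA EB ℓ).EB k,
        (U3Objects₁₁.ofFixed Rr.carriers EA EB ℓ).θ₅, (U3Objects₁₁.ofFixed Rr.carriers EA EB ℓ).C₅,
        (U3Objects₁₁.ofFixed Rr.carriers EA EB ℓ).moduli, (U3Objects₁₁.ofFixed Rr.carriers EA EB ℓ).C₉,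
        (U3Objects₁₁.ofFixed Rr.carriers EA EB ℓ).ω, (U3Objects₁₁.ofFixed Rr.carriers EA EB ℓ).cr,
        (U3Objects₁₁.ofFixed Rr.carriers EA EB ℓ).ρ⟩ := by
  have h := n18At_of_envelopeOnRecord Rr M hrep hC3 hε₁ hκ hrate hKP hH l01 l02 l03 l05 l06 l07 l08 l09aff l09blind l09hom l09unit
    hE₁ hδ hθ hθθ' hθ'1 hcH hω hρ₀ l10near hB l10first hS ℓ.moduli ℓ.C₉ ℓ.ω ℓ.cr ℓ.ρ
  -- the END's constant is nonnegative: `N18At` at one member bounds an absolute value … we avoid that detour and read the sign off the letters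
  have hθ'0 : 0 ≤ θ' := hθ.trans hθθ'
  have hC₅0 : 0 ≤ (Real.exp 1 * 9 * 64 * K₀ 64 8 ^ 2 * (C3 * ε₁) / (1 - ρ₀) * (δ + δ') + B) * (θ' - ω) /
      (θ' - (ω + Real.exp 1 * 9 * 64 * K₀ 64 8 ^ 2 * (C3 * ε₁) / (1 - ρ₀) * cH)) := by
    have hK : 0 ≤ K₀ 64 8 := (B12TreeDecay.K₀_pos 64 8).le
    have hG : 0 ≤ Real.exp 1 * 9 * 64 * K₀ 64 8 ^ 2 * (C3 * ε₁) / (1 - ρ₀) := by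
      have : 0 < 1 - ρ₀ := sub_pos.2 hρ₀
      positivity
    have hl11 : ω + Real.exp 1 * 9 * 64 * K₀ 64 8 ^ 2 * (C3 * ε₁) / (1 - ρ₀) * cH < θ' := by
      have h1 := smallness_of_eps (G := Real.exp 1 * 9 * 64 * K₀ 64 8 ^ 2 * C3) (cI := cH) (ε₁ := ε₁) hρ₀ hS
      have heq : Real.exp 1 * 9 * 64 * K₀ 64 8 ^ 2 * C3 / (1 - ρ₀) * (cH * ε₁) =
          Real.exp 1 * 9 * 64 * K₀ 64 8 ^ 2 * (C3 * ε₁) / (1 - ρ₀) * cH := by ring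
      rwa [heq] at h1
    refine div_nonneg (mul_nonneg (by positivity) (sub_nonneg.2 ?_)) (sub_nonneg.2 hl11.le)
    have : 0 ≤ Real.exp 1 * 9 * 64 * K₀ 64 8 ^ 2 * (C3 * ε₁) / (1 - ρ₀) * cH := mul_nonneg hG hcH
    linarith
  exact n18At_level_ofFixed_of_mono ℓ k h hW hγ hℓκ hθ'0 hℓθ hC₅0 hℓC

end FixedEnvelope

/-! ## §3 The tower reading `U3Tower₁₁.objects` -/

section Tower

variable (t : U3Tower₁₁) (ℓ : U3Letters₁₁) (γ : ℝ) (k : ℕ)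

/-- **TOWER READING: N18 AT LEVEL `k` FROM ANY BUNDLE CARRYING `N18At`, BY COMAP + WINDOW AGREEMENT** [bookkeeping] — module 3's `n18At_comap_congr` at the
home's literal: given a U3 bundle `v` with `N18At v` (module 1 ∕ 2's H-layer bundle on `TwoRuns.carriers`, n18-a's primitive-rate bundle, …), maps of the tower's
physical domains and backgrounds into `v`'s carriers that at level `k` preserve the scale (`v.C.scale (φD X) = k − t.r X`) and the tree length and commute with
the transports (`φA (t.tr k U) = v.C.transport (φB U)`), AGREEMENT on `Window γ` of the level functional `t.E k` (at transported backgrounds) and of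
`t.E (k+1) ∘ prependCoupling b` (`b ∈ ]0, γ]`) with `v`'s functionals read through the maps, and letters of record DOMINATING `v`'s
(`Window γ ⊆ v.W`, `γ ≤ v.γ`, `ℓ.κ ≤ v.κ`, `0 ≤ v.θ ≤ ℓ.θ₅`, `0 ≤ v.C₅ ≤ ℓ.C₅`): N18 holds at the home's level-`k` bundle of `t.objects ℓ`.
[cite: Balaban1987RG1, (0.24)–(0.25) p.257, (1.18) p.263, Thm 1 p.259] -/
theorem n18At_level_tower_of_comap_agree (v : U3Carriers) (hv : N18At v) (φD : t.Dom → v.C.Dom) (φA : t.B → v.C.BgA) (φB : t.B → v.C.BgB)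
    (hscale : ∀ X, v.C.scale (φD X) = k - t.r X) (hd : ∀ X, v.C.d (φD X) = t.d X) (htr : ∀ U, φA (t.tr k U) = v.C.transport (φB U))
    (hA : ∀ g ∈ Window γ, ∀ (U : t.B) (X : t.Dom), t.E k g (t.tr k U) X = v.EA g (φA (t.tr k U)) (φD X))
    (hB : ∀ b : ℝ, 0 < b → b ≤ γ → ∀ g ∈ Window γ, ∀ (U : t.B) (X : t.Dom),
      t.E (k + 1) (prependCoupling b g) U X = v.EB b g (φB U) (φD X))
    (hW : Window γ ⊆ v.W) (hγ : γ ≤ v.γ) (hκ : ℓ.κ ≤ v.κ) (hθ : 0 ≤ v.θ) (hθ' : v.θ ≤ ℓ.θ₅) (hC₅ : 0 ≤ v.C₅) (hC : v.C₅ ≤ ℓ.C₅) :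
    N18At ⟨(t.objects ℓ).levelCarriers k, Window γ, γ, (t.objects ℓ).κ, (t.objects ℓ).EA k, (t.objects ℓ).EB k, (t.objects ℓ).θ₅,
      (t.objects ℓ).C₅, (t.objects ℓ).moduli, (t.objects ℓ).C₉, (t.objects ℓ).ω, (t.objects ℓ).cr, (t.objects ℓ).ρ⟩ := by
  obtain ⟨C, W, γv, κv, EAv, EBv, θv, C₅v, Λv, C₉v, ωv, crv, ρv⟩ := v
  -- `N18At v` at the dominated letters, on the record's window
  have hv' : N18At ⟨C, Window γ, γ, ℓ.κ, EAv, EBv, ℓ.θ₅, ℓ.C₅, ℓ.moduli, ℓ.C₉, ℓ.ω, ℓ.cr, ℓ.ρ⟩ := n18At_mono hv hW hγ hκ hθ hθ' hC₅ hC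
  exact n18At_comap_congr (C' := t.levelCarriers k) φD φA φB hscale hd htr hv' hA hB ℓ.moduli ℓ.C₉ ℓ.ω ℓ.cr ℓ.ρ

end Tower

end YMDAG.N18.HLayer

end
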